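import Literature.NumberTheory.GaloisRepresentations.LubinTateColemanUnitsImageGaloisTopologyTwo
import HarnessLib

/-!
# The `ℤ/d`-trace of the two-variable Coleman image: `N_Σ = Σ_j N(j)`, `Col_Σ(C) = Σ_j Col(C)(j)` as closed `Λ`-submodules of the
# ONE-PRIME coordinate module, for an unramified tower of ARBITRARY degree `d·p^m` (de Shalit I §3.7 / III §1.3–1.4 read on the
# part of the Iwasawa algebra that is trivial on the prime-to-`p` torsion)

De Shalit, *Iwasawa theory of elliptic curves with complex multiplication* (1987), Ch. I §3.1, §3.4, §3.7 (13), §3.8 (17); Ch. III §1.3–1.4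
(`i : 𝒰(𝔣) → Λ(𝒢)`, `i(𝒞̄) = μ(𝔣)Λ₀`, and the `χ`-components for characters `χ` of the torsion of `𝒢`).  In the tree the two-variable Coleman
transform at `q = 2` lands in `M = (ZMod d → M₁)` (`M₁ = ColemanCoordModule`, the index `ZMod d` = the prime-to-`p` part `ℤ/d` of
`Gal(E_∞/F) ≅ ℤ/d × ℤ_p`; `LubinTateColemanUnitsImageModuleTwo`, `…EquivTwo`, `…GaloisTwo`, `…GaloisTopologyTwo`).  The `χ`-part machinery of
the brick-(c) chain (`LubinTateColemanCoordCoinvariantCharTwo`: `char (N/C)_ε = char (Λ/φ_ε(C))` for `C ≤ N ≤ M₁`) lives in `M₁`, and so far `N`,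
`Col(C)` were transported to `M₁` only for `d = 1` (`LinearEquiv.funUnique`).  THIS file provides the transport for EVERY `d` along the
**index trace** `Σ : M → M₁`, `G ↦ Σ_{j ∈ ℤ/d} G(j)` — the projection onto the part on which `ℤ/d` acts trivially (the only part a character of
`2`-power order sees; on the unit side `Σ ∘ Col` is `Col ∘ N_{ℤ/d}`, the norm to the `ℤ_p`-subtower):

* §1 `indexTraceₗ` (+ `_apply`), ★ `indexTraceₗ_indexShiftₗ` (the trace kills the `ℤ/d`-shifts), `indexTraceₗ_compLeft`, ★ `indexTraceₗ_galOpₗ`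
  (`Σ ∘ 𝒯_{v,g,s} = σ_v ∘ (C g •) ∘ Σ` — NO shift left), `indexTraceₗ_const` (`Σ(const G) = d•G`), `isUnit_natCast_of_coprime`,
  ★ `indexTraceₗ_surjective` (`d` a unit), `continuous_indexTraceₗ`;
* §2 `unitsImageTrace := N.map Σ ≤ M₁` (+ `mem_…_iff`, `indexTraceₗ_mem_…`), ★ `unitTwistₗ_mem_unitsImageTrace` (`σ_v N_Σ ≤ N_Σ`);
* §3 `smul_mem_of_isClosed_of_ops₁` (the `M₁`-form of `smul_mem_of_isClosed_of_ops`), ★★ **`colemanImageTrace C`** — for `C ⊆ 𝒰¹_∞` closed,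
  `∋ 1`, closed under products, inverses and `Γ_F`: `Σ(Col C)` is a CLOSED `Λ = 𝒪_F⟦X⟧⟦T⟧`-SUBMODULE of `M₁` for EVERY `d` (`ℕ` dense in `𝒪_F`):
  closed (compact image), `σ_v`-stable, and `C(1+X)•`-stable because `Σ(C(1+X) • shift₁ G) = C(1+X) • Σ G`; `mem_colemanImageTrace_iff`,
  `indexTraceₗ_colemanImage_mem_colemanImageTrace`, `isClosed_colemanImageTrace`, ★ `colemanImageTrace_le_unitsImageTrace`.

No `d = 1` hypothesis anywhere.  For `d = 1`, `Σ` is evaluation at the unique index and these are the objects `unitsImage₁` /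
`colemanImageSubmodule₁` of the Summits-side (c)-chain.  Cell `bsd-print-cf2`, width seat `bsd-line-cf2c-w7` g17.

## References
* E. de Shalit, *Iwasawa theory of elliptic curves with complex multiplication* (1987), Ch. I §3.1, §3.4 Lemma (ii), §3.7 (13), §3.8 (17);
  Ch. III §1.3–1.4, §1.8. [deShalit1987]
* L. C. Washington, *Introduction to Cyclotomic Fields* (1997), §13.2 (compact `Λ`-modules). [Washington1997]
* N. Bourbaki, *General Topology* Ch. I §9.4 Cor. 2 (continuous images of compact sets). [BourbakiGT1]
-/

noncomputable section

open Filter Topology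
open scoped PowerSeries.WithPiTopology

namespace Literature.NumberTheory.GaloisRepresentations

section UnitsImageTraceTwo

open GaloisRepresentations.IsNonarchimedeanLocalField LubinTate ValuativeRel Field Finset

variable {F : Type} [Field F] [ValuativeRel F] [TopologicalSpace F] [IsNonarchimedeanLocalField F]

attribute [local instance] ltNormUniformSpace ltNormIsUniformAddGroup rk1 nF nE fintypeResidueField

variable {p : ℕ} [hp : Fact p.Prime] {d : ℕ} (hd : d.Coprime p)
variable {π : 𝒪[F]} (hπ : (valuation F).IsUniformizer (π : F))
variable (E : ℕ → IntermediateField F (AlgebraicClosure F)) [∀ m, FiniteDimensional F (E m)] [∀ m, Normal F (E m)]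
  [∀ m, IsGalois F (E m)] (hmono : Monotone E) (hE : ∀ m, E m ≤ maxUnramified F) (hdeg : ∀ m, Module.finrank F (E m) = d * p ^ m)
  {σ₀ : absoluteGaloisGroup F} (hσ₀ : IsAbsArithFrob σ₀) (hq : residueFieldCard F = 2)
variable (u : (LTCoeff F)ˣ) (hu : LTCoeff.of F π = residueFieldCard F * u) (γ : 𝒪[F]ˣ)

/-! ### §1. The index trace `Σ : (ZMod d → M₁) → M₁` -/

section Trace

variable [IsAdicComplete (Ideal.span {intBase F (LTCoeff.of F π)}) (PowerSeries 𝒪[F])] [NeZero d]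

/-- **The `ℤ/d`-index trace `Σ G := Σ_{j ∈ ℤ/d} G(j)`**, a `Λ`-linear map `M = (ZMod d → M₁) → M₁`: the projection of the completed group
ring of `ℤ/d × ℤ_p` onto that of `ℤ_p` (push-forward of measures along `ℤ/d × ℤ_p → ℤ_p`). [cite: deShalit1987, Ch. I §3.1, §3.7 (13)] -/
def indexTraceₗ : (ZMod d → ColemanCoordModule hπ hq (intBase F) u hu γ) →ₗ[PowerSeries (PowerSeries 𝒪[F])]
    ColemanCoordModule hπ hq (intBase F) u hu γ :=
  ∑ j : ZMod d, LinearMap.proj j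

omit hp in
/-- Unfolding `indexTraceₗ`: `Σ G = Σ_j G(j)`. [cite: deShalit1987, Ch. I §3.1] -/
theorem indexTraceₗ_apply (G : ZMod d → ColemanCoordModule hπ hq (intBase F) u hu γ) :
    indexTraceₗ hπ hq u hu γ G = ∑ j : ZMod d, G j := by
  rw [indexTraceₗ, LinearMap.sum_apply]
  rfl

omit hp in
/-- ★ **The trace kills the `ℤ/d`-shifts**: `Σ (shift_s G) = Σ G`. [cite: deShalit1987, Ch. I §3.1] -/
theorem indexTraceₗ_indexShiftₗ (s : ZMod d) (G : ZMod d → ColemanCoordModule hπ hq (intBase F) u hu γ) :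
    indexTraceₗ hπ hq u hu γ (indexShiftₗ hπ hq u hu γ s G) = indexTraceₗ hπ hq u hu γ G := by
  rw [indexTraceₗ_apply, indexTraceₗ_apply]
  simp only [indexShiftₗ_apply]
  exact Fintype.sum_equiv (Equiv.subRight s) _ _ fun j => rfl

omit hp in
/-- `Σ` commutes with componentwise linear maps: `Σ (f ∘ G) = f (Σ G)`. [cite: deShalit1987, Ch. I §3.4 Lemma (ii)] -/
theorem indexTraceₗ_compLeft (f : ColemanCoordModule hπ hq (intBase F) u hu γ →ₗ[PowerSeries (PowerSeries 𝒪[F])] ColemanCoordModule hπ hq (intBase F) u hu γ)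
    (G : ZMod d → ColemanCoordModule hπ hq (intBase F) u hu γ) :
    indexTraceₗ hπ hq u hu γ (f.compLeft (ZMod d) G) = f (indexTraceₗ hπ hq u hu γ G) := by
  rw [indexTraceₗ_apply, indexTraceₗ_apply, map_sum]
  rfl

omit hp in
/-- ★ **`Σ ∘ 𝒯_{v,g,s} = σ_v ∘ (C g •) ∘ Σ`**: on the trace the Galois operator `galOpₗ v g s = σ_v ∘ (C g •) ∘ shift_s` loses its `ℤ/d`-shift.
[cite: deShalit1987, Ch. I §3.1, §3.4 Lemma (ii)] -/
theorem indexTraceₗ_galOpₗ (v : 𝒪[F]ˣ) (g : PowerSeries 𝒪[F]) (s : ZMod d) (G : ZMod d → ColemanCoordModule hπ hq (intBase F) u hu γ) :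
    indexTraceₗ hπ hq u hu γ (galOpₗ hπ hq u hu γ v g s G) =
      unitTwistₗ hπ hq (intBase F) u hu γ v ((PowerSeries.C g : PowerSeries (PowerSeries 𝒪[F])) • indexTraceₗ hπ hq u hu γ G) := by
  rw [indexTraceₗ_apply, indexTraceₗ_apply, Finset.smul_sum, map_sum]
  simp only [galOpₗ_apply]
  exact Fintype.sum_equiv (Equiv.subRight s) _ _ fun j => rfl

omit hp in
/-- `Σ` of a constant family is `d • G`. [cite: deShalit1987, Ch. I §3.1] -/
theorem indexTraceₗ_const (G : ColemanCoordModule hπ hq (intBase F) u hu γ) :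
    indexTraceₗ hπ hq u hu γ (fun _ : ZMod d => G) = ((d : ℕ) : PowerSeries (PowerSeries 𝒪[F])) • G := by
  rw [indexTraceₗ_apply, Finset.sum_const, Finset.card_univ, ZMod.card, Nat.cast_smul_eq_nsmul]

omit hp [NeZero d] in
include hd in
/-- **`d` prime to `p` is a unit of `𝒪_F`** when `p` is a non-unit of the local ring `𝒪_F` (`(p) ≠ ⊤`). [cite: Washington1997, §13.2] -/
theorem isUnit_natCast_of_coprime (hI : Ideal.span {(p : 𝒪[F])} ≠ ⊤) : IsUnit ((d : ℕ) : 𝒪[F]) := by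
  by_contra h
  have hdm : ((d : ℕ) : 𝒪[F]) ∈ IsLocalRing.maximalIdeal 𝒪[F] := (IsLocalRing.mem_maximalIdeal _).mpr (mem_nonunits_iff.mpr h)
  have hpm : ((p : ℕ) : 𝒪[F]) ∈ IsLocalRing.maximalIdeal 𝒪[F] :=
    IsLocalRing.le_maximalIdeal hI (Ideal.mem_span_singleton_self _)
  obtain ⟨a, b, hab⟩ := Nat.isCoprime_iff_coprime.mpr hd
  have h1 : (1 : 𝒪[F]) ∈ IsLocalRing.maximalIdeal 𝒪[F] := by
    have e := congrArg (Int.cast : ℤ → 𝒪[F]) hab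
    push_cast at e
    rw [← e]
    exact Ideal.add_mem _ (Ideal.mul_mem_left _ _ hdm) (Ideal.mul_mem_left _ _ hpm)
  exact (Ideal.ne_top_iff_one _).mp (IsLocalRing.maximalIdeal.isMaximal 𝒪[F]).ne_top h1

omit hp in
/-- ★ **`Σ` is onto `M₁`** when `d` is a unit of `𝒪_F`: `Σ (const (d⁻¹ • G)) = G`. [cite: deShalit1987, Ch. I §3.7 (13)] -/
theorem indexTraceₗ_surjective (hdu : IsUnit ((d : ℕ) : 𝒪[F])) : Function.Surjective (indexTraceₗ hπ hq u hu γ (d := d)) := by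
  intro G
  obtain ⟨e, he⟩ := hdu
  refine ⟨fun _ => (PowerSeries.C (PowerSeries.C ((e⁻¹ : 𝒪[F]ˣ) : 𝒪[F])) : PowerSeries (PowerSeries 𝒪[F])) • G, ?_⟩
  rw [indexTraceₗ_const, ← mul_smul, ← map_natCast (PowerSeries.C (R := PowerSeries 𝒪[F])) d,
    ← map_natCast (PowerSeries.C (R := 𝒪[F])) d, ← he, ← map_mul, ← map_mul, Units.mul_inv, map_one, map_one, one_smul]

omit hp in
/-- `Σ` is continuous. [cite: BourbakiGT1, Ch. I §9.4 Cor. 2] -/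
theorem continuous_indexTraceₗ : Continuous (indexTraceₗ hπ hq u hu γ (d := d)) := by
  have e : (indexTraceₗ hπ hq u hu γ (d := d) : (ZMod d → ColemanCoordModule hπ hq (intBase F) u hu γ) → _) =
      fun G => ∑ j : ZMod d, G j := funext fun G => indexTraceₗ_apply hπ hq u hu γ G
  rw [e]
  exact continuous_finsetSum _ fun j _ => continuous_apply j

end Trace

/-! ### §2. `N_Σ = Σ(N)`, the trace of the image of the Coleman map -/

section UnitsImage

variable [IsAdicComplete (Ideal.span {intBase F (LTCoeff.of F π)}) (PowerSeries 𝒪[F])] [NeZero d]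
  [IsAdicComplete (Ideal.span {(p : 𝒪[F])}) 𝒪[F]]
variable {θ : ∀ m, unitBall (E m)} (hθ : ∀ m, IsIntegralNormalGen (E m) (θ m))
  (hcoh : ∀ m, unitBallTrace (hmono (Nat.le_succ m)) (θ (m + 1)) = θ m)
variable [CharZero F] (hI : Ideal.span {(p : 𝒪[F])} ≠ ⊤) (hud : ∀ m, (u : LTCoeff F) ^ Module.finrank F (E m) ≠ 1)

/-- **`unitsImageTrace`** — `N_Σ := Σ(N) ≤ M₁`, the index trace of the image `N = Col(𝒰¹_∞)` of the two-variable Coleman map (any `d`).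
[cite: deShalit1987, Ch. I §3.7 (13), §3.8 (17)] -/
def unitsImageTrace : Submodule (PowerSeries (PowerSeries 𝒪[F])) (ColemanCoordModule hπ hq (intBase F) u hu γ) :=
  (unitsImage hd hπ E hmono hE hdeg hσ₀ hq u hu γ hθ hcoh hI hud).map (indexTraceₗ hπ hq u hu γ)

/-- Membership in `N_Σ`. [cite: deShalit1987, Ch. I §3.8 (17)] -/
theorem mem_unitsImageTrace_iff (G : ColemanCoordModule hπ hq (intBase F) u hu γ) :
    G ∈ unitsImageTrace hd hπ E hmono hE hdeg hσ₀ hq u hu γ hθ hcoh hI hud ↔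
      ∃ G' ∈ unitsImage hd hπ E hmono hE hdeg hσ₀ hq u hu γ hθ hcoh hI hud, indexTraceₗ hπ hq u hu γ G' = G :=
  Submodule.mem_map

/-- `Σ G' ∈ N_Σ` for `G' ∈ N`. [cite: deShalit1987, Ch. I §3.8 (17)] -/
theorem indexTraceₗ_mem_unitsImageTrace {G' : ZMod d → ColemanCoordModule hπ hq (intBase F) u hu γ}
    (hG' : G' ∈ unitsImage hd hπ E hmono hE hdeg hσ₀ hq u hu γ hθ hcoh hI hud) :
    indexTraceₗ hπ hq u hu γ G' ∈ unitsImageTrace hd hπ E hmono hE hdeg hσ₀ hq u hu γ hθ hcoh hI hud :=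
  Submodule.mem_map_of_mem hG'

include hE hdeg hσ₀ hcoh in
/-- ★ **`σ_v N_Σ ≤ N_Σ`** for every `v ∈ 𝒪_F^×` (`σ_v` acts componentwise on `N` and commutes with `Σ`). [cite: deShalit1987, Ch. I §3.4 Lemma (ii); Ch. III §1.3] -/
theorem unitTwistₗ_mem_unitsImageTrace (v : 𝒪[F]ˣ) {G : ColemanCoordModule hπ hq (intBase F) u hu γ}
    (hG : G ∈ unitsImageTrace hd hπ E hmono hE hdeg hσ₀ hq u hu γ hθ hcoh hI hud) :
    unitTwistₗ hπ hq (intBase F) u hu γ v G ∈ unitsImageTrace hd hπ E hmono hE hdeg hσ₀ hq u hu γ hθ hcoh hI hud := by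
  obtain ⟨G', hG', rfl⟩ := (mem_unitsImageTrace_iff hd hπ E hmono hE hdeg hσ₀ hq u hu γ hθ hcoh hI hud G).mp hG
  rw [← indexTraceₗ_compLeft]
  exact indexTraceₗ_mem_unitsImageTrace hd hπ E hmono hE hdeg hσ₀ hq u hu γ hθ hcoh hI hud
    (unitTwistₗ_compLeft_mem_unitsImage hπ E hmono hE hdeg hσ₀ hq u hu γ hθ hcoh hI hud v hG')

end UnitsImage

/-! ### §3. `Col_Σ(C) = Σ(Col C)` is a closed `Λ`-submodule of `M₁`, for every `d` -/

section Image

variable [IsAdicComplete (Ideal.span {intBase F (LTCoeff.of F π)}) (PowerSeries 𝒪[F])]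

omit hp in
/-- **The one-prime form of `smul_mem_of_isClosed_of_ops`**: a CLOSED subgroup `Z ≤ M₁` stable under `σ_γ = (1+T)•` and `C(1+X)•` is a
`Λ`-submodule when `ℕ` is dense in `𝒪_F` (transport along `M₁ = (ZMod 1 → M₁)(0)`). [cite: deShalit1987, Ch. III §1.4] [cite: Washington1997, §13.2] -/
theorem smul_mem_of_isClosed_of_ops₁ (hN : DenseRange (Nat.cast : ℕ → 𝒪[F]))
    {Z : AddSubgroup (ColemanCoordModule hπ hq (intBase F) u hu γ)} (hZ : IsClosed (Z : Set (ColemanCoordModule hπ hq (intBase F) u hu γ)))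
    (hγ : ∀ G ∈ Z, unitTwistₗ hπ hq (intBase F) u hu γ γ G ∈ Z)
    (hφ : ∀ G ∈ Z, (PowerSeries.C (1 + PowerSeries.X) : PowerSeries (PowerSeries 𝒪[F])) • G ∈ Z)
    (c : PowerSeries (PowerSeries 𝒪[F])) {G : ColemanCoordModule hπ hq (intBase F) u hu γ} (hG : G ∈ Z) : c • G ∈ Z := by
  let Z' : AddSubgroup (ZMod 1 → ColemanCoordModule hπ hq (intBase F) u hu γ) :=
    Z.comap (Pi.evalAddMonoidHom (fun _ : ZMod 1 => ColemanCoordModule hπ hq (intBase F) u hu γ) 0)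
  have hZ' : IsClosed (Z' : Set (ZMod 1 → ColemanCoordModule hπ hq (intBase F) u hu γ)) := hZ.preimage (continuous_apply 0)
  have h := smul_mem_of_isClosed_of_ops hπ hq u hu γ hN (Z := Z') hZ' (fun G' hG' => hγ _ hG') (fun G' hG' => hφ _ hG') c
    (G := fun _ : ZMod 1 => G) hG
  exact h

variable [NeZero d] [IsAdicComplete (Ideal.span {(p : 𝒪[F])}) 𝒪[F]]
variable {θ : ∀ m, unitBall (E m)} (hθ : ∀ m, IsIntegralNormalGen (E m) (θ m))
  (hcoh : ∀ m, unitBallTrace (hmono (Nat.le_succ m)) (θ (m + 1)) = θ m)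

include hdeg in
/-- **`Σ(Col C)` as an additive subgroup of `M₁`** (image of `colemanImageSubgroup`). [cite: deShalit1987, Ch. I §3.4 Lemma (i); Ch. III §1.4] -/
def colemanImageTraceSubgroup (C : Set (∀ m, RelNormCoherentUnits hπ (E m))) (hCsub : C ⊆ principalCoherentFamilies hπ E hmono)
    (h1 : (fun m => (RelNormCoherentUnits.one : RelNormCoherentUnits hπ (E m))) ∈ C)
    (hmul : ∀ β ∈ C, ∀ β' ∈ C, (fun m => (β m).mul (β' m)) ∈ C) (hinv : ∀ β ∈ C, (fun m => (β m).inv hπ (E m)) ∈ C) :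
    AddSubgroup (ColemanCoordModule hπ hq (intBase F) u hu γ) :=
  (colemanImageSubgroup hd hπ E hmono hE hdeg hσ₀ hq u hu γ hθ hcoh C hCsub h1 hmul hinv).map (indexTraceₗ hπ hq u hu γ).toAddMonoidHom

include hdeg in
/-- Its carrier is `Σ '' Col(C)`. [cite: deShalit1987, Ch. III §1.4] -/
theorem coe_colemanImageTraceSubgroup (C : Set (∀ m, RelNormCoherentUnits hπ (E m))) (hCsub : C ⊆ principalCoherentFamilies hπ E hmono)
    (h1 : (fun m => (RelNormCoherentUnits.one : RelNormCoherentUnits hπ (E m))) ∈ C)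
    (hmul : ∀ β ∈ C, ∀ β' ∈ C, (fun m => (β m).mul (β' m)) ∈ C) (hinv : ∀ β ∈ C, (fun m => (β m).inv hπ (E m)) ∈ C) :
    (colemanImageTraceSubgroup hd hπ E hmono hE hdeg hσ₀ hq u hu γ hθ hcoh C hCsub h1 hmul hinv : Set _) =
      indexTraceₗ hπ hq u hu γ '' colemanImageSet hd hπ E hmono hE hdeg hσ₀ hq u hu γ hθ hcoh C := by
  rw [colemanImageTraceSubgroup, AddSubgroup.coe_map, coe_colemanImageSubgroup]
  rfl

include hdeg in
/-- **`Σ(Col C)` is CLOSED** for closed `C` (continuous image of a compact set in the Hausdorff `M₁`). [cite: BourbakiGT1, Ch. I §9.4 Cor. 2]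
[cite: deShalit1987, Ch. III §1.4] -/
theorem isClosed_image_indexTraceₗ_colemanImageSet {C : Set (∀ m, RelNormCoherentUnits hπ (E m))} (hC : IsClosed C) :
    IsClosed (indexTraceₗ hπ hq u hu γ '' colemanImageSet hd hπ E hmono hE hdeg hσ₀ hq u hu γ hθ hcoh C) :=
  ((isClosed_colemanImageSet hd hπ E hmono hE hdeg hσ₀ hq u hu γ hθ hcoh hC).isCompact.image (continuous_indexTraceₗ hπ hq u hu γ)).isClosed

include hdeg hE hmono in
/-- ★★ **`Σ(Col C)` is a `Λ = 𝒪_F⟦X⟧⟦T⟧`-SUBMODULE of `M₁`, for EVERY `d`**, for a closed `Γ_F`-stable subgroup `C ⊆ 𝒰¹_∞` and `ℕ` dense in `𝒪_F`: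
closed, `σ_γ`-stable (`unitTwistₗ_mem_colemanImageSet`), and `C(1+X)•`-stable since `Σ(C(1+X) • shift₁ G) = C(1+X) • Σ G`
(`C_one_add_X_smul_indexShiftₗ_mem_colemanImageSet` + `indexTraceₗ_indexShiftₗ`) — de Shalit III.1.4's `i(𝒞̄)` on the part trivial under `ℤ/d`.
[cite: deShalit1987, Ch. III §1.4] [cite: Washington1997, §13.2] -/
theorem smul_mem_image_indexTraceₗ_colemanImageSet (hN : DenseRange (Nat.cast : ℕ → 𝒪[F]))
    {C : Set (∀ m, RelNormCoherentUnits hπ (E m))} (hC : IsClosed C) (hCsub : C ⊆ principalCoherentFamilies hπ E hmono)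
    (h1 : (fun m => (RelNormCoherentUnits.one : RelNormCoherentUnits hπ (E m))) ∈ C)
    (hmul : ∀ β ∈ C, ∀ β' ∈ C, (fun m => (β m).mul (β' m)) ∈ C) (hinv : ∀ β ∈ C, (fun m => (β m).inv hπ (E m)) ∈ C)
    (hgal : ∀ σ : absoluteGaloisGroup F, ∀ β ∈ C, (fun m => (β m).galAct σ) ∈ C)
    (c : PowerSeries (PowerSeries 𝒪[F])) {G : ColemanCoordModule hπ hq (intBase F) u hu γ}
    (hG : G ∈ indexTraceₗ hπ hq u hu γ '' colemanImageSet hd hπ E hmono hE hdeg hσ₀ hq u hu γ hθ hcoh C) :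
    c • G ∈ indexTraceₗ hπ hq u hu γ '' colemanImageSet hd hπ E hmono hE hdeg hσ₀ hq u hu γ hθ hcoh C := by
  have hZ := isClosed_image_indexTraceₗ_colemanImageSet hd hπ E hmono hE hdeg hσ₀ hq u hu γ hθ hcoh hC
  rw [← coe_colemanImageTraceSubgroup hd hπ E hmono hE hdeg hσ₀ hq u hu γ hθ hcoh C hCsub h1 hmul hinv] at hZ hG ⊢
  refine smul_mem_of_isClosed_of_ops₁ hπ hq u hu γ hN hZ (fun G' hG' => ?_) (fun G' hG' => ?_) c hG
  · obtain ⟨G₀, hG₀, rfl⟩ := AddSubgroup.mem_map.mp hG'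
    refine AddSubgroup.mem_map.mpr ⟨fun j => unitTwistₗ hπ hq (intBase F) u hu γ γ (G₀ j),
      unitTwistₗ_mem_colemanImageSet hd hπ E hmono hE hdeg hσ₀ hq u hu γ hθ hcoh hgal γ hG₀, ?_⟩
    change indexTraceₗ hπ hq u hu γ ((unitTwistₗ hπ hq (intBase F) u hu γ γ).compLeft (ZMod d) G₀) = _
    rw [indexTraceₗ_compLeft]
    rfl
  · obtain ⟨G₀, hG₀, rfl⟩ := AddSubgroup.mem_map.mp hG'
    refine AddSubgroup.mem_map.mpr ⟨_, C_one_add_X_smul_indexShiftₗ_mem_colemanImageSet hd hπ E hmono hE hdeg hσ₀ hq u hu γ hθ hcoh hgal hG₀, ?_⟩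
    change indexTraceₗ hπ hq u hu γ _ = _ • indexTraceₗ hπ hq u hu γ G₀
    rw [map_smul, indexTraceₗ_indexShiftₗ]

include hdeg hE hmono in
/-- ★★ **`colemanImageTrace C`** — `Col_Σ(C) := Σ(Col C)` as a `Λ`-submodule of `M₁` (any `d`; hypotheses of
`smul_mem_image_indexTraceₗ_colemanImageSet`). [cite: deShalit1987, Ch. III §1.4] -/
def colemanImageTrace (hN : DenseRange (Nat.cast : ℕ → 𝒪[F]))
    (C : Set (∀ m, RelNormCoherentUnits hπ (E m))) (hC : IsClosed C) (hCsub : C ⊆ principalCoherentFamilies hπ E hmono)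
    (h1 : (fun m => (RelNormCoherentUnits.one : RelNormCoherentUnits hπ (E m))) ∈ C)
    (hmul : ∀ β ∈ C, ∀ β' ∈ C, (fun m => (β m).mul (β' m)) ∈ C) (hinv : ∀ β ∈ C, (fun m => (β m).inv hπ (E m)) ∈ C)
    (hgal : ∀ σ : absoluteGaloisGroup F, ∀ β ∈ C, (fun m => (β m).galAct σ) ∈ C) :
    Submodule (PowerSeries (PowerSeries 𝒪[F])) (ColemanCoordModule hπ hq (intBase F) u hu γ) where
  carrier := indexTraceₗ hπ hq u hu γ '' colemanImageSet hd hπ E hmono hE hdeg hσ₀ hq u hu γ hθ hcoh C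
  add_mem' {a b} ha hb := by
    rw [← coe_colemanImageTraceSubgroup hd hπ E hmono hE hdeg hσ₀ hq u hu γ hθ hcoh C hCsub h1 hmul hinv] at ha hb ⊢
    exact AddSubgroup.add_mem _ ha hb
  zero_mem' := by
    rw [← coe_colemanImageTraceSubgroup hd hπ E hmono hE hdeg hσ₀ hq u hu γ hθ hcoh C hCsub h1 hmul hinv]
    exact AddSubgroup.zero_mem _
  smul_mem' c _ hG := smul_mem_image_indexTraceₗ_colemanImageSet hd hπ E hmono hE hdeg hσ₀ hq u hu γ hθ hcoh hN hC hCsub h1 hmul hinv hgal c hG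

include hdeg hE hmono in
/-- Membership in `Col_Σ(C)`: `G ∈ Col_Σ(C) ↔ ∃ G' ∈ Col(C), Σ G' = G`. [cite: deShalit1987, Ch. III §1.4] -/
theorem mem_colemanImageTrace_iff {hN : DenseRange (Nat.cast : ℕ → 𝒪[F])}
    {C : Set (∀ m, RelNormCoherentUnits hπ (E m))} {hC : IsClosed C} {hCsub : C ⊆ principalCoherentFamilies hπ E hmono}
    {h1 : (fun m => (RelNormCoherentUnits.one : RelNormCoherentUnits hπ (E m))) ∈ C}
    {hmul : ∀ β ∈ C, ∀ β' ∈ C, (fun m => (β m).mul (β' m)) ∈ C} {hinv : ∀ β ∈ C, (fun m => (β m).inv hπ (E m)) ∈ C}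
    {hgal : ∀ σ : absoluteGaloisGroup F, ∀ β ∈ C, (fun m => (β m).galAct σ) ∈ C} {G : ColemanCoordModule hπ hq (intBase F) u hu γ} :
    G ∈ colemanImageTrace hd hπ E hmono hE hdeg hσ₀ hq u hu γ hθ hcoh hN C hC hCsub h1 hmul hinv hgal ↔
      ∃ G' ∈ colemanImageSet hd hπ E hmono hE hdeg hσ₀ hq u hu γ hθ hcoh C, indexTraceₗ hπ hq u hu γ G' = G :=
  Set.mem_image _ _ _

include hdeg hE hmono in
/-- `Σ (Col β) ∈ Col_Σ(C)` for `β ∈ C`. [cite: deShalit1987, Ch. III §1.4] -/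
theorem indexTraceₗ_colemanImage_mem_colemanImageTrace {hN : DenseRange (Nat.cast : ℕ → 𝒪[F])}
    {C : Set (∀ m, RelNormCoherentUnits hπ (E m))} {hC : IsClosed C} {hCsub : C ⊆ principalCoherentFamilies hπ E hmono}
    {h1 : (fun m => (RelNormCoherentUnits.one : RelNormCoherentUnits hπ (E m))) ∈ C}
    {hmul : ∀ β ∈ C, ∀ β' ∈ C, (fun m => (β m).mul (β' m)) ∈ C} {hinv : ∀ β ∈ C, (fun m => (β m).inv hπ (E m)) ∈ C}
    {hgal : ∀ σ : absoluteGaloisGroup F, ∀ β ∈ C, (fun m => (β m).galAct σ) ∈ C}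
    {β : ∀ m, RelNormCoherentUnits hπ (E m)} (hβ : β ∈ principalCoherentFamilies hπ E hmono) (hβC : β ∈ C) :
    indexTraceₗ hπ hq u hu γ (colemanImage hd hπ E hmono hE hdeg hσ₀ hq u hu γ hθ hcoh hβ.1) ∈
      colemanImageTrace hd hπ E hmono hE hdeg hσ₀ hq u hu γ hθ hcoh hN C hC hCsub h1 hmul hinv hgal :=
  (mem_colemanImageTrace_iff hd hπ E hmono hE hdeg hσ₀ hq u hu γ hθ hcoh).mpr
    ⟨_, colemanImage_mem_colemanImageSet hd hπ E hmono hE hdeg hσ₀ hq u hu γ hθ hcoh hβ hβC, rfl⟩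

include hdeg hE hmono in
/-- `Col_Σ(C)` is closed in `M₁`. [cite: deShalit1987, Ch. III §1.4] [cite: BourbakiGT1, Ch. I §9.4 Cor. 2] -/
theorem isClosed_colemanImageTrace {hN : DenseRange (Nat.cast : ℕ → 𝒪[F])}
    {C : Set (∀ m, RelNormCoherentUnits hπ (E m))} {hC : IsClosed C} {hCsub : C ⊆ principalCoherentFamilies hπ E hmono}
    {h1 : (fun m => (RelNormCoherentUnits.one : RelNormCoherentUnits hπ (E m))) ∈ C}
    {hmul : ∀ β ∈ C, ∀ β' ∈ C, (fun m => (β m).mul (β' m)) ∈ C} {hinv : ∀ β ∈ C, (fun m => (β m).inv hπ (E m)) ∈ C}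
    {hgal : ∀ σ : absoluteGaloisGroup F, ∀ β ∈ C, (fun m => (β m).galAct σ) ∈ C} :
    IsClosed (colemanImageTrace hd hπ E hmono hE hdeg hσ₀ hq u hu γ hθ hcoh hN C hC hCsub h1 hmul hinv hgal :
      Set (ColemanCoordModule hπ hq (intBase F) u hu γ)) :=
  isClosed_image_indexTraceₗ_colemanImageSet hd hπ E hmono hE hdeg hσ₀ hq u hu γ hθ hcoh hC

variable [CharZero F] (hI : Ideal.span {(p : 𝒪[F])} ≠ ⊤) (hud : ∀ m, (u : LTCoeff F) ^ Module.finrank F (E m) ≠ 1)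
  (hm : ∃ m₁ : ℕ, LTCoeff.of F π ^ 2 ∣ LTCoeff.of F π - m₁)

include hdeg hE hmono hm in
/-- ★ **`Col_Σ(C) ≤ N_Σ`**. [cite: deShalit1987, Ch. III §1.3–1.4] -/
theorem colemanImageTrace_le_unitsImageTrace (hN : DenseRange (Nat.cast : ℕ → 𝒪[F]))
    (C : Set (∀ m, RelNormCoherentUnits hπ (E m))) (hC : IsClosed C) (hCsub : C ⊆ principalCoherentFamilies hπ E hmono)
    (h1 : (fun m => (RelNormCoherentUnits.one : RelNormCoherentUnits hπ (E m))) ∈ C)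
    (hmul : ∀ β ∈ C, ∀ β' ∈ C, (fun m => (β m).mul (β' m)) ∈ C) (hinv : ∀ β ∈ C, (fun m => (β m).inv hπ (E m)) ∈ C)
    (hgal : ∀ σ : absoluteGaloisGroup F, ∀ β ∈ C, (fun m => (β m).galAct σ) ∈ C) :
    colemanImageTrace hd hπ E hmono hE hdeg hσ₀ hq u hu γ hθ hcoh hN C hC hCsub h1 hmul hinv hgal ≤
      unitsImageTrace hd hπ E hmono hE hdeg hσ₀ hq u hu γ hθ hcoh hI hud := by
  intro G hG
  obtain ⟨G', hG', rfl⟩ := (mem_colemanImageTrace_iff hd hπ E hmono hE hdeg hσ₀ hq u hu γ hθ hcoh).mp hG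
  exact indexTraceₗ_mem_unitsImageTrace hd hπ E hmono hE hdeg hσ₀ hq u hu γ hθ hcoh hI hud
    (colemanImageSet_subset_unitsImage hd hπ E hmono hE hdeg hσ₀ hq u hu γ hθ hcoh hI hud hm C hG')

end Image

end UnitsImageTraceTwo

end Literature.NumberTheory.GaloisRepresentations
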